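import Mathlib

/-!
# N21 (NE7c) · JOINT LETTER SELECTION OVER SEVERAL INDICATOR FAMILIES — the product-box pigeonhole (fibred double counting: each
# family's collars are counted along ITS OWN letter grid with the other families' letters frozen) and the TWO-RUN COMMON ARGMIN on an
# arbitrary finite index set; the two-grid instance `range (n₁+1) ×ˢ range (n₂+1)` and the one-grid compatibility check (generic)

WIDTH SEAT `pub-ymgap-dag-n21-w7` (g2), node N21 = NE7c (NOT PRINTED; NOT proved at print's fixed thresholds); lane K3⁷ `SpineGivenEndpointR13SepCoPH`
(stmt-QuantumFields-20544, `--supports … --as helper`; COUNT-NEUTRAL).  THEOREMS ONLY (0 `def`), Mathlib only — no object of NODE 00 is touched.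

WHY (located against the lane owner's road, `pub-ymgap-dag-n21-d/ROAD-S.md` §2 and the header of `…N21GappedTopCut13CoPHDefs` (dag-n21-d g11, p617809):
«ONLY the (2.17)∕(3.2) factor family of the TOP step is re-lettered (the (3.3) `b|_{2δ_k}` family … — their two-run shells are LOCATED, not typed)»).
Under `T4IndicatorShell`'s design (i) (identical core indicators `χ^Aχ^B` in both runs, mixed pieces to the bad class) EVERY background-mediated indicator family
of the top 𝐓-step needs the gapped treatment, and the top step carries TWO such families on the same cube index `Iχ`: the (3.2) family `a|_θ` (letter `θ`,
def-T FILE 19 `aWeightAt`) and the (3.3) family `b|_{δ′}` (letter `δ′`, `bWeightAt`; [Balaban1988Convergent] (3.3) p. 265, the `χ′`-factors test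
`SmallApproxFluct … twoδ`, letter-monotone, unity `Σ_Q b|_{δ′} = 1` at every `δ′` = `B14.Sect3Decomp.eq33`).  The (M1)-free count of the gapped road
(`…N21GappedTopCut13CoPHCount.sum_range_sum_topGapShell_le`: along ONE grid `θ_i = ε(1−ρ)^i` the two-sided collars of ONE family count each cube ≤ 2 times,
the term re-summing to the same partition function at every letter) bounds family `a`'s collars summed over `i` AT A FROZEN letter of family `b`, and conversely;
a one-grid argmin per family does NOT compose AT THE LEVEL OF THE ACTUAL COLLAR WEIGHTS (family `a`'s collar weight at depth `i` depends on family `b`'s letter `j`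
and conversely).  THIS FILE selects ONE letter PAIR `(i⋆, j⋆)` — and, abstractly, one point of any finite box for any finite set of families — light for ALL
families in BOTH runs, by double counting over the product box: `Σ_{(i,j)} (sh_a + sh_b) = Σ_j Σ_i sh_a + Σ_i Σ_j sh_b ≤ (n_b+1)·C_a·Z + (n_a+1)·C_b·Z`, so the minimum
over the `(n_a+1)(n_b+1)` pairs is at most `(C_a∕(n_a+1) + C_b∕(n_b+1))·Z`; the two-run common point costs the factor `2` of the lane owner's `argmin_badness_bounds`
(re-proved here on an arbitrary `Finset`).
CORRECTION-1 (v1.1, cell bus 2026-08-28 10:01Z, concurred by the lane owner 10:02Z): on the lane owner's road the collar weights are bounded through MAJORANTS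
(`…N21GappedTopCut13CoPHCount.sum_topGapShellAt_le_integral_collar`: `Σ_{s′} shellᵃ_i ≤ ∫ collarᵃ_i(Ū)·Σ_s h_s(U) dU`) in which the unity of the step weights at
letters kills the OTHER family's letter; at that level the families SEPARATE, the two depths are selected by two INDEPENDENT one-grid argmins
(`exists_common_single_le` twice — done in this seat's `…N21GappedTopPair13CoPHCount.exists_common_depths_topGap2Shell_le`), and the product-box lemmas below are
an ALTERNATIVE with the SAME numeral (`2(C₁∕(n₁+1) + C₂∕(n₂+1))` at `C = 2·#cubes`), the right tool only where majorants are not letter-separable.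

WHAT THIS FILE PROVES ([folklore] finite-sum bookkeeping; every theorem generic over its index types).
* §1 `exists_le_of_sum_le_mul` (min ≤ mean, relative form on a nonempty `Finset`); ★ `exists_common_le_of_sum_le` (TWO nonnegative families on one nonempty
  `Finset` with total masses `≤ M_f`, `≤ M_g`: some point has `f ≤ 2M_f∕#B` AND `g ≤ 2M_g∕#B` — the argmin of `f∕M_f + g∕M_g`, degenerate masses included);
  `exists_common_le_of_sum_le_mul` (relative form `M := C·S`; `…N21ShellSplitSelected13CoPH.argmin_badness_bounds` is the case `B = range m`).
* §2 FIBRED DOUBLE COUNTING for a finite set of families `Φs`, a box `B : Finset β`, line maps `π φ : β → γ` and shells `sh φ : β → ℝ` with the PER-LINE count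
  `Σ_{b ∈ B, π φ b = c} sh φ b ≤ C φ · Z`: `sum_le_card_image_mul` (one family: `Σ_B sh ≤ #lines · C · Z`), ★★ `sum_sum_le_sum_card_image_mul`
  (`Σ_{b∈B} Σ_φ sh φ b ≤ Σ_φ #(B.image (π φ))·C φ·Z`), ★★ `exists_joint_le` (`∃ b ∈ B, Σ_φ sh φ b ≤ (Σ_φ #lines_φ·C φ ∕ #B)·Z`), ★★★ `exists_common_joint_le`
  (two runs, ONE point `b`: the same bound doubled, in EACH run, with each run's own counts `C^A`, `C^B` and masses `Z^A`, `Z^B`).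
* §3 THE TWO-GRID INSTANCE (direct proof by `Finset.sum_product`): ★★★ `exists_common_pair_le` on `range (n₁+1) ×ˢ range (n₂+1)` — line hypotheses
  `∀ j ≤ n₂, Σ_{i ≤ n₁} sh₁ (i, j) ≤ C₁·Z` and `∀ i ≤ n₁, Σ_{j ≤ n₂} sh₂ (i, j) ≤ C₂·Z` in each run ⇒ ONE pair `(i, j)` with
  `sh₁ (i,j) + sh₂ (i,j) ≤ 2·(C₁∕(n₁+1) + C₂∕(n₂+1))·Z` in EACH run (`exists_pair_le`: one run, without the factor `2`); and the ONE-GRID compatibility check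
  ★ `exists_common_single_le` (`Σ_{i ≤ n} sh i ≤ C·Z` per run ⇒ a common `i ≤ n` with `sh i ≤ (2C∕(n+1))·Z` per run — with `C := 2·(2L^m)⁴` this is EXACTLY the numeral
  `4(2L^m)⁴∕(n+1)` of `…N21GappedTopCut13CoPHCount.exists_common_depth_topGapShell_le`).
* §4 THE `m`-FAMILY BOX `piFinset (fun φ => range (n φ + 1))` (families `φ : Φ`, a `Fintype`): the line along coordinate `φ` through a base point is the image of `φ`'s grid
  (`piBox_line_eq`, `sum_piBox_line_eq`), `#lines · (n φ + 1) = #box` (`card_lines_mul_eq_card_piBox`), and ★★★ `exists_common_joint_piBox_le`: under the NATURAL per-line counts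
  «for every point `c` of the box, `Σ_{j ≤ n φ} sh φ (update c φ j) ≤ C φ · Z`» in each run, some COMMON letter vector has `Σ_φ sh φ ≤ 2·(Σ_φ C φ∕(n φ+1))·Z` in EACH run.
Deliberately NOT here (offered to the lane owner dag-n21-d on the bus, first refusal): the (3.3) family's gapped weight `bGapAt δlo δhi`, its collar functional along a
`δ′`-grid, the cover ∕ graph ∕ count ∕ Record twins of `…N21GappedTopCut13CoPH{Defs,,Count,Record}` for that family, and the reading carrying a selected PAIR.

HONEST FRAMING (binding).  [folklore] bookkeeping (double counting + «the minimum is below the mean»); NO object of NODE 00 touched, NO spine reading typed, nothing of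
Bałaban's asserted or used; the closeness input, the two-run site identification and the core sandwich (NE7 proper) are the consumer's; NE7c NOT PRINTED ∕ NOT proved at
print's fixed thresholds; N21 NOT discharged; K3⁷ NOT claimed; counts UNMOVED (typed 28∕28 · discharged 5∕27, A 5∕28); never a count claim.  No `sorry`, no `axiom`, no
`def`, no `instance`, no `notation`.  One finite four-torus programme at fixed `ε` — NOT ℝ⁴, NOT OS, NOT a mass gap, NOT the Clay problem.
-/

open scoped BigOperators
open Finset

namespace Summit.QuantumFields.YangMills.Theorems.N21JointLetterSelection

/-! ## §1 The minimum is below the mean; the two-run common argmin on an arbitrary finite index set -/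

section Argmin

variable {β : Type*}

/-- **MIN ≤ MEAN, relative form**: on a nonempty finite index set, `Σ_B f ≤ C·S` forces some `b ∈ B` with `f b ≤ (C∕#B)·S`. [folklore] -/
theorem exists_le_of_sum_le_mul {B : Finset β} (hB : B.Nonempty) {f : β → ℝ} {C S : ℝ} (hf : ∑ b ∈ B, f b ≤ C * S) :
    ∃ b ∈ B, f b ≤ C / #B * S := by
  refine Finset.exists_le_of_sum_le hB (hf.trans (le_of_eq ?_))
  have hc : (#B : ℝ) ≠ 0 := by exact_mod_cast (Finset.card_pos.2 hB).ne'
  rw [Finset.sum_const, nsmul_eq_mul]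
  field_simp

/-- ★ **THE TWO-RUN COMMON ARGMIN** on an arbitrary nonempty finite index set: two nonnegative families `f`, `g` with total masses `Σ_B f ≤ M_f`, `Σ_B g ≤ M_g` have a
COMMON point `b ∈ B` with `f b ≤ 2·M_f∕#B` AND `g b ≤ 2·M_g∕#B` — the argmin of the normalised badness `f∕M_f + g∕M_g` (a weightless family, `M = 0`, vanishes identically
and Lean's `x ∕ 0 = 0` keeps the argument uniform).  [folklore; the `B = range m` case with `M := C·S` is `…N21ShellSplitSelected13CoPH.argmin_badness_bounds` (dag-n21-d),
whose proof is adapted here] -/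
theorem exists_common_le_of_sum_le {B : Finset β} (hB : B.Nonempty) {f g : β → ℝ} {Mf Mg : ℝ} (hf0 : ∀ b ∈ B, 0 ≤ f b) (hg0 : ∀ b ∈ B, 0 ≤ g b)
    (hf : ∑ b ∈ B, f b ≤ Mf) (hg : ∑ b ∈ B, g b ≤ Mg) :
    ∃ b ∈ B, f b ≤ 2 * Mf / #B ∧ g b ≤ 2 * Mg / #B := by
  have hm : (0 : ℝ) < #B := by exact_mod_cast Finset.card_pos.2 hB
  have hMf : 0 ≤ Mf := (Finset.sum_nonneg hf0).trans hf
  have hMg : 0 ≤ Mg := (Finset.sum_nonneg hg0).trans hg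
  obtain ⟨b₀, hb₀, hmin⟩ := B.exists_min_image (fun b => f b / Mf + g b / Mg) hB
  -- each normalised total is at most `1`
  have hF : (∑ b ∈ B, f b) / Mf ≤ 1 := by
    rcases eq_or_lt_of_le hMf with h | h
    · rw [← h, div_zero]; exact zero_le_one
    · rw [div_le_one h]; exact hf
  have hG : (∑ b ∈ B, g b) / Mg ≤ 1 := by
    rcases eq_or_lt_of_le hMg with h | h
    · rw [← h, div_zero]; exact zero_le_one
    · rw [div_le_one h]; exact hg
  -- the minimum is below the mean
  have hsum : (#B : ℝ) * (f b₀ / Mf + g b₀ / Mg) ≤ 2 := by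
    calc (#B : ℝ) * (f b₀ / Mf + g b₀ / Mg) = ∑ _b ∈ B, (f b₀ / Mf + g b₀ / Mg) := by rw [Finset.sum_const, nsmul_eq_mul]
      _ ≤ ∑ b ∈ B, (f b / Mf + g b / Mg) := Finset.sum_le_sum hmin
      _ = (∑ b ∈ B, f b) / Mf + (∑ b ∈ B, g b) / Mg := by rw [Finset.sum_add_distrib, Finset.sum_div, Finset.sum_div]
      _ ≤ 2 := by linarith
  have hbad : f b₀ / Mf + g b₀ / Mg ≤ 2 / #B := by rw [le_div_iff₀ hm]; linarith
  have hfpart : f b₀ / Mf ≤ 2 / #B := le_trans (le_add_of_nonneg_right (div_nonneg (hg0 b₀ hb₀) hMg)) hbad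
  have hgpart : g b₀ / Mg ≤ 2 / #B := le_trans (le_add_of_nonneg_left (div_nonneg (hf0 b₀ hb₀) hMf)) hbad
  refine ⟨b₀, hb₀, ?_, ?_⟩
  · rcases eq_or_lt_of_le hMf with h | h
    · -- weightless family: all of `f` vanishes on `B`
      have hle : f b₀ ≤ ∑ b ∈ B, f b := Finset.single_le_sum hf0 hb₀
      have : f b₀ ≤ 0 := hle.trans (hf.trans (le_of_eq h.symm))
      have h2 : 0 ≤ 2 * Mf / #B := by positivity
      linarith
    · rw [div_le_iff₀ h] at hfpart
      calc f b₀ ≤ 2 / #B * Mf := hfpart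
        _ = 2 * Mf / #B := by ring
  · rcases eq_or_lt_of_le hMg with h | h
    · have hle : g b₀ ≤ ∑ b ∈ B, g b := Finset.single_le_sum hg0 hb₀
      have : g b₀ ≤ 0 := hle.trans (hg.trans (le_of_eq h.symm))
      have h2 : 0 ≤ 2 * Mg / #B := by positivity
      linarith
    · rw [div_le_iff₀ h] at hgpart
      calc g b₀ ≤ 2 / #B * Mg := hgpart
        _ = 2 * Mg / #B := by ring

/-- **THE TWO-RUN COMMON ARGMIN, relative form** (`M_f := C_f·S_f`, `M_g := C_g·S_g`): some common `b ∈ B` has `f b ≤ (2C_f∕#B)·S_f` and `g b ≤ (2C_g∕#B)·S_g`.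
[folklore; `argmin_badness_bounds` (dag-n21-d) is `B = range m`, `C_f = C_g`] -/
theorem exists_common_le_of_sum_le_mul {B : Finset β} (hB : B.Nonempty) {f g : β → ℝ} {Cf Cg Sf Sg : ℝ} (hf0 : ∀ b ∈ B, 0 ≤ f b) (hg0 : ∀ b ∈ B, 0 ≤ g b)
    (hf : ∑ b ∈ B, f b ≤ Cf * Sf) (hg : ∑ b ∈ B, g b ≤ Cg * Sg) :
    ∃ b ∈ B, f b ≤ 2 * Cf / #B * Sf ∧ g b ≤ 2 * Cg / #B * Sg := by
  obtain ⟨b, hb, h₁, h₂⟩ := exists_common_le_of_sum_le hB hf0 hg0 hf hg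
  exact ⟨b, hb, h₁.trans (le_of_eq (by ring)), h₂.trans (le_of_eq (by ring))⟩

end Argmin

/-! ## §2 Fibred double counting: several families, one box, each family counted along its own lines -/

section DoubleCounting

variable {Φ β γ : Type*} [DecidableEq γ]

/-- **ONE FAMILY, COUNTED ALONG ITS LINES**: if on every line `{b ∈ B | π b = c}` the shells sum to at most `C·Z`, then over the whole box they sum to at most
`#(lines)·C·Z`. [folklore: `Finset.sum_fiberwise_of_maps_to`] -/
theorem sum_le_card_image_mul {B : Finset β} (π : β → γ) {sh : β → ℝ} {C Z : ℝ}
    (hline : ∀ c ∈ B.image π, ∑ b ∈ B with π b = c, sh b ≤ C * Z) :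
    ∑ b ∈ B, sh b ≤ #(B.image π) * (C * Z) := by
  rw [← Finset.sum_fiberwise_of_maps_to (fun b hb => Finset.mem_image_of_mem π hb) sh]
  calc ∑ c ∈ B.image π, ∑ b ∈ B with π b = c, sh b ≤ ∑ _c ∈ B.image π, C * Z := Finset.sum_le_sum hline
    _ = #(B.image π) * (C * Z) := by rw [Finset.sum_const, nsmul_eq_mul]

/-- ★★ **SEVERAL FAMILIES, DOUBLE COUNTING**: with the per-line count `Σ_{b ∈ B, π φ b = c} sh φ b ≤ C φ · Z` for every family `φ ∈ Φs` and every line `c` of that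
family, the total shell mass over the box is at most `Σ_φ #(lines of φ)·C φ·Z` (swap the two sums, then count each family along its own lines). [folklore] -/
theorem sum_sum_le_sum_card_image_mul {B : Finset β} (Φs : Finset Φ) (π : Φ → β → γ) {sh : Φ → β → ℝ} {C : Φ → ℝ} {Z : ℝ}
    (hline : ∀ φ ∈ Φs, ∀ c ∈ B.image (π φ), ∑ b ∈ B with π φ b = c, sh φ b ≤ C φ * Z) :
    ∑ b ∈ B, ∑ φ ∈ Φs, sh φ b ≤ ∑ φ ∈ Φs, #(B.image (π φ)) * (C φ * Z) := by
  rw [Finset.sum_comm]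
  exact Finset.sum_le_sum fun φ hφ => sum_le_card_image_mul (π φ) (hline φ hφ)

/-- ★★ **JOINT LETTER SELECTION (one run)**: under the per-line counts, SOME point of the box is light for ALL families at once:
`∃ b ∈ B, Σ_φ sh φ b ≤ ((Σ_φ #(lines of φ)·C φ) ∕ #B)·Z`.  For a product box `#(lines of φ) ∕ #B = 1∕(n_φ + 1)` (the length of family `φ`'s own grid), §3. [folklore] -/
theorem exists_joint_le {B : Finset β} (hB : B.Nonempty) (Φs : Finset Φ) (π : Φ → β → γ) {sh : Φ → β → ℝ} {C : Φ → ℝ} {Z : ℝ}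
    (hline : ∀ φ ∈ Φs, ∀ c ∈ B.image (π φ), ∑ b ∈ B with π φ b = c, sh φ b ≤ C φ * Z) :
    ∃ b ∈ B, ∑ φ ∈ Φs, sh φ b ≤ (∑ φ ∈ Φs, #(B.image (π φ)) * C φ) / #B * Z := by
  refine exists_le_of_sum_le_mul hB ((sum_sum_le_sum_card_image_mul Φs π hline).trans (le_of_eq ?_))
  rw [Finset.sum_mul]
  exact Finset.sum_congr rfl fun φ _ => by ring

/-- ★★★ **JOINT LETTER SELECTION, TWO RUNS, ONE COMMON POINT**: two runs with nonnegative shells `shA φ`, `shB φ` on the SAME box and lines, per-line counts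
`≤ C^A φ·Z^A` resp. `≤ C^B φ·Z^B`: some `b ∈ B` has `Σ_φ shA φ b ≤ 2·((Σ_φ #lines_φ·C^A φ) ∕ #B)·Z^A` AND `Σ_φ shB φ b ≤ 2·((Σ_φ #lines_φ·C^B φ) ∕ #B)·Z^B`
(§1's common argmin on the family totals). [folklore] -/
theorem exists_common_joint_le {B : Finset β} (hB : B.Nonempty) (Φs : Finset Φ) (π : Φ → β → γ) {shA shB : Φ → β → ℝ} {CA CB : Φ → ℝ} {ZA ZB : ℝ}
    (hA0 : ∀ φ ∈ Φs, ∀ b ∈ B, 0 ≤ shA φ b) (hB0 : ∀ φ ∈ Φs, ∀ b ∈ B, 0 ≤ shB φ b)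
    (hlineA : ∀ φ ∈ Φs, ∀ c ∈ B.image (π φ), ∑ b ∈ B with π φ b = c, shA φ b ≤ CA φ * ZA)
    (hlineB : ∀ φ ∈ Φs, ∀ c ∈ B.image (π φ), ∑ b ∈ B with π φ b = c, shB φ b ≤ CB φ * ZB) :
    ∃ b ∈ B, ∑ φ ∈ Φs, shA φ b ≤ 2 * (∑ φ ∈ Φs, #(B.image (π φ)) * CA φ) / #B * ZA ∧
      ∑ φ ∈ Φs, shB φ b ≤ 2 * (∑ φ ∈ Φs, #(B.image (π φ)) * CB φ) / #B * ZB := by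
  have hA : ∑ b ∈ B, ∑ φ ∈ Φs, shA φ b ≤ (∑ φ ∈ Φs, #(B.image (π φ)) * CA φ) * ZA := by
    refine (sum_sum_le_sum_card_image_mul Φs π hlineA).trans (le_of_eq ?_)
    rw [Finset.sum_mul]
    exact Finset.sum_congr rfl fun φ _ => by ring
  have hB' : ∑ b ∈ B, ∑ φ ∈ Φs, shB φ b ≤ (∑ φ ∈ Φs, #(B.image (π φ)) * CB φ) * ZB := by
    refine (sum_sum_le_sum_card_image_mul Φs π hlineB).trans (le_of_eq ?_)
    rw [Finset.sum_mul]
    exact Finset.sum_congr rfl fun φ _ => by ring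
  exact exists_common_le_of_sum_le_mul hB (fun b hb => Finset.sum_nonneg fun φ hφ => hA0 φ hφ b hb)
    (fun b hb => Finset.sum_nonneg fun φ hφ => hB0 φ hφ b hb) hA hB'

end DoubleCounting

/-! ## §3 The two-grid instance (two indicator families of one 𝐓-step, each with its own letter grid) and the one-grid compatibility check -/

section TwoGrids

/-- **TWO GRIDS, DOUBLE COUNTING**: on the box `range (n₁+1) ×ˢ range (n₂+1)`, if family 1's shells sum to `≤ C₁·Z` along every line `j = const` and family 2's to
`≤ C₂·Z` along every line `i = const`, then `Σ_{(i,j)} (sh₁ + sh₂) ≤ ((n₂+1)·C₁ + (n₁+1)·C₂)·Z`. [folklore: `Finset.sum_product` ∕ `Finset.sum_product_right`] -/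
theorem sum_pair_le {n₁ n₂ : ℕ} {sh₁ sh₂ : ℕ × ℕ → ℝ} {C₁ C₂ Z : ℝ}
    (h₁ : ∀ j ∈ Finset.range (n₂ + 1), ∑ i ∈ Finset.range (n₁ + 1), sh₁ (i, j) ≤ C₁ * Z)
    (h₂ : ∀ i ∈ Finset.range (n₁ + 1), ∑ j ∈ Finset.range (n₂ + 1), sh₂ (i, j) ≤ C₂ * Z) :
    ∑ b ∈ Finset.range (n₁ + 1) ×ˢ Finset.range (n₂ + 1), (sh₁ b + sh₂ b) ≤ ((n₂ + 1 : ℕ) * C₁ + (n₁ + 1 : ℕ) * C₂) * Z := by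
  rw [Finset.sum_add_distrib, Finset.sum_product_right, Finset.sum_product]
  have hs₁ : ∑ j ∈ Finset.range (n₂ + 1), ∑ i ∈ Finset.range (n₁ + 1), sh₁ (i, j) ≤ (n₂ + 1 : ℕ) * (C₁ * Z) := by
    calc ∑ j ∈ Finset.range (n₂ + 1), ∑ i ∈ Finset.range (n₁ + 1), sh₁ (i, j) ≤ ∑ _j ∈ Finset.range (n₂ + 1), C₁ * Z := Finset.sum_le_sum h₁
      _ = (n₂ + 1 : ℕ) * (C₁ * Z) := by rw [Finset.sum_const, Finset.card_range, nsmul_eq_mul]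
  have hs₂ : ∑ i ∈ Finset.range (n₁ + 1), ∑ j ∈ Finset.range (n₂ + 1), sh₂ (i, j) ≤ (n₁ + 1 : ℕ) * (C₂ * Z) := by
    calc ∑ i ∈ Finset.range (n₁ + 1), ∑ j ∈ Finset.range (n₂ + 1), sh₂ (i, j) ≤ ∑ _i ∈ Finset.range (n₁ + 1), C₂ * Z := Finset.sum_le_sum h₂
      _ = (n₁ + 1 : ℕ) * (C₂ * Z) := by rw [Finset.sum_const, Finset.card_range, nsmul_eq_mul]
  linarith

/-- **JOINT PAIR (one run)**: under the two line counts, SOME pair `(i, j)` of the box has `sh₁ (i,j) + sh₂ (i,j) ≤ (C₁∕(n₁+1) + C₂∕(n₂+1))·Z` (min ≤ mean over the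
`(n₁+1)(n₂+1)` pairs). [folklore] -/
theorem exists_pair_le {n₁ n₂ : ℕ} {sh₁ sh₂ : ℕ × ℕ → ℝ} {C₁ C₂ Z : ℝ}
    (h₁ : ∀ j ∈ Finset.range (n₂ + 1), ∑ i ∈ Finset.range (n₁ + 1), sh₁ (i, j) ≤ C₁ * Z)
    (h₂ : ∀ i ∈ Finset.range (n₁ + 1), ∑ j ∈ Finset.range (n₂ + 1), sh₂ (i, j) ≤ C₂ * Z) :
    ∃ b ∈ Finset.range (n₁ + 1) ×ˢ Finset.range (n₂ + 1), sh₁ b + sh₂ b ≤ (C₁ / (n₁ + 1 : ℕ) + C₂ / (n₂ + 1 : ℕ)) * Z := by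
  have hne : (Finset.range (n₁ + 1) ×ˢ Finset.range (n₂ + 1)).Nonempty := ⟨(0, 0), by simp⟩
  obtain ⟨b, hb, h⟩ := exists_le_of_sum_le_mul hne (sum_pair_le h₁ h₂)
  refine ⟨b, hb, h.trans (le_of_eq ?_)⟩
  rw [Finset.card_product, Finset.card_range, Finset.card_range]
  have ha : ((n₁ + 1 : ℕ) : ℝ) ≠ 0 := by positivity
  have hb' : ((n₂ + 1 : ℕ) : ℝ) ≠ 0 := by positivity
  push_cast
  field_simp

/-- ★★★ **JOINT PAIR, TWO RUNS, ONE COMMON PAIR**: run A (shells `shA₁`, `shA₂`, mass `Z^A`) and run B (`shB₁`, `shB₂`, `Z^B`) on the same two grids, nonnegative shells,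
the two line counts in each run ⇒ some COMMON pair `(i, j)`, `i ≤ n₁`, `j ≤ n₂`, has `shA₁ + shA₂ ≤ 2·(C₁∕(n₁+1) + C₂∕(n₂+1))·Z^A` AND `shB₁ + shB₂ ≤ 2·(C₁∕(n₁+1) + C₂∕(n₂+1))·Z^B`
there.  Intended reading (NOT typed here): grid 1 = the (3.2) letters `θ_i = ε(1−ρ)^i` of the top step, grid 2 = the (3.3) letters `δ′_j = 2δ_k(1−ρ′)^j`, `sh₁ (i,j)` ∕ `sh₂ (i,j)` =
the two-sided collar shells of the two families at the letter pair, `C₁ = C₂ = 2·#(top cubes)`, `Z` = the run's dressed partition sum. [folklore] -/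
theorem exists_common_pair_le {n₁ n₂ : ℕ} {shA₁ shA₂ shB₁ shB₂ : ℕ × ℕ → ℝ} {C₁ C₂ ZA ZB : ℝ}
    (hA₁0 : ∀ b ∈ Finset.range (n₁ + 1) ×ˢ Finset.range (n₂ + 1), 0 ≤ shA₁ b) (hA₂0 : ∀ b ∈ Finset.range (n₁ + 1) ×ˢ Finset.range (n₂ + 1), 0 ≤ shA₂ b)
    (hB₁0 : ∀ b ∈ Finset.range (n₁ + 1) ×ˢ Finset.range (n₂ + 1), 0 ≤ shB₁ b) (hB₂0 : ∀ b ∈ Finset.range (n₁ + 1) ×ˢ Finset.range (n₂ + 1), 0 ≤ shB₂ b)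
    (hA₁ : ∀ j ∈ Finset.range (n₂ + 1), ∑ i ∈ Finset.range (n₁ + 1), shA₁ (i, j) ≤ C₁ * ZA)
    (hA₂ : ∀ i ∈ Finset.range (n₁ + 1), ∑ j ∈ Finset.range (n₂ + 1), shA₂ (i, j) ≤ C₂ * ZA)
    (hB₁ : ∀ j ∈ Finset.range (n₂ + 1), ∑ i ∈ Finset.range (n₁ + 1), shB₁ (i, j) ≤ C₁ * ZB)
    (hB₂ : ∀ i ∈ Finset.range (n₁ + 1), ∑ j ∈ Finset.range (n₂ + 1), shB₂ (i, j) ≤ C₂ * ZB) :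
    ∃ b ∈ Finset.range (n₁ + 1) ×ˢ Finset.range (n₂ + 1),
      shA₁ b + shA₂ b ≤ 2 * (C₁ / (n₁ + 1 : ℕ) + C₂ / (n₂ + 1 : ℕ)) * ZA ∧ shB₁ b + shB₂ b ≤ 2 * (C₁ / (n₁ + 1 : ℕ) + C₂ / (n₂ + 1 : ℕ)) * ZB := by
  have hne : (Finset.range (n₁ + 1) ×ˢ Finset.range (n₂ + 1)).Nonempty := ⟨(0, 0), by simp⟩
  obtain ⟨b, hb, h₁, h₂⟩ := exists_common_le_of_sum_le_mul hne (fun b hb => add_nonneg (hA₁0 b hb) (hA₂0 b hb))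
    (fun b hb => add_nonneg (hB₁0 b hb) (hB₂0 b hb)) (sum_pair_le hA₁ hA₂) (sum_pair_le hB₁ hB₂)
  have hcard : (#(Finset.range (n₁ + 1) ×ˢ Finset.range (n₂ + 1)) : ℝ) = (n₁ + 1 : ℕ) * (n₂ + 1 : ℕ) := by
    rw [Finset.card_product, Finset.card_range, Finset.card_range, Nat.cast_mul]
  have ha : ((n₁ + 1 : ℕ) : ℝ) ≠ 0 := by positivity
  have hb' : ((n₂ + 1 : ℕ) : ℝ) ≠ 0 := by positivity
  have key : 2 * ((n₂ + 1 : ℕ) * C₁ + (n₁ + 1 : ℕ) * C₂) / #(Finset.range (n₁ + 1) ×ˢ Finset.range (n₂ + 1)) =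
      2 * (C₁ / (n₁ + 1 : ℕ) + C₂ / (n₂ + 1 : ℕ)) := by
    rw [hcard]
    field_simp
  refine ⟨b, hb, ?_, ?_⟩
  · rw [← key]; exact h₁
  · rw [← key]; exact h₂

/-- ★ **ONE GRID, TWO RUNS (compatibility check with the lane owner's numeral)**: `Σ_{i ≤ n} sh i ≤ C·Z` in each run ⇒ a common `i ≤ n` with `sh i ≤ (2C∕(n+1))·Z` in each run.
With `C := 2·(2L^m)⁴` (the two-sided collar count of `…N21GappedTopCut13CoPHCount.sum_range_sum_topGapShell_le`) the numeral is `4(2L^m)⁴∕(n+1)` — EXACTLY that of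
`exists_common_depth_topGapShell_le`; the two-grid numeral of `exists_common_pair_le` with equal grids `n₁ = n₂ = n` and `C₁ = C₂ = C` is `8(2L^m)⁴∕(n+1)`·(each run's `Z`)
for the SUM of the two families' collars. [folklore] -/
theorem exists_common_single_le {n : ℕ} {shA shB : ℕ → ℝ} {C ZA ZB : ℝ} (hA0 : ∀ i ∈ Finset.range (n + 1), 0 ≤ shA i) (hB0 : ∀ i ∈ Finset.range (n + 1), 0 ≤ shB i)
    (hA : ∑ i ∈ Finset.range (n + 1), shA i ≤ C * ZA) (hB : ∑ i ∈ Finset.range (n + 1), shB i ≤ C * ZB) :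
    ∃ i ∈ Finset.range (n + 1), shA i ≤ 2 * C / (n + 1 : ℕ) * ZA ∧ shB i ≤ 2 * C / (n + 1 : ℕ) * ZB := by
  have hne : (Finset.range (n + 1)).Nonempty := ⟨0, by simp⟩
  obtain ⟨i, hi, h₁, h₂⟩ := exists_common_le_of_sum_le_mul hne hA0 hB0 hA hB
  rw [Finset.card_range] at h₁ h₂
  exact ⟨i, hi, h₁, h₂⟩

/-- **NUMERAL CHECK** for the compatibility remark: `2·(2·X)∕(n+1) = 4·X∕(n+1)` and `2·(2X∕(n+1) + 2X∕(n+1)) = 8·X∕(n+1)` (`X` = the top cube count). [bookkeeping] -/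
theorem numeral_check (X : ℝ) (n : ℕ) :
    2 * (2 * X) / (n + 1 : ℕ) = 4 * X / (n + 1 : ℕ) ∧ 2 * (2 * X / (n + 1 : ℕ) + 2 * X / (n + 1 : ℕ)) = 8 * X / (n + 1 : ℕ) := by
  constructor <;> ring

end TwoGrids

/-! ## §4 The `m`-family box `piFinset (fun φ => range (n φ + 1))`: the lines along one coordinate, their count, and the joint selection under the natural
per-line hypotheses («for every point of the box, family `φ`'s shells along `φ`'s own grid through that point sum to `≤ C φ · Z`») -/

section PiBox

variable {Φ : Type*} [Fintype Φ] [DecidableEq Φ]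

/-- Zeroing one coordinate keeps a point in the box (every grid contains depth `0`). [bookkeeping] -/
theorem update_zero_mem_piBox {n : Φ → ℕ} {b : Φ → ℕ} (hb : b ∈ Fintype.piFinset fun φ => Finset.range (n φ + 1)) (φ : Φ) :
    Function.update b φ 0 ∈ Fintype.piFinset fun φ => Finset.range (n φ + 1) := by
  rw [Fintype.mem_piFinset] at hb ⊢
  intro ψ
  by_cases h : ψ = φ
  · subst h; rw [Function.update_self]; exact Finset.mem_range.2 (Nat.succ_pos _)
  · rw [Function.update_of_ne h]; exact hb ψ

/-- **THE LINE ALONG COORDINATE `φ` THROUGH A BASE POINT `c` (`c φ = 0`)** is the image of `φ`'s grid under `j ↦ update c φ j`. [bookkeeping] -/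
theorem piBox_line_eq {n : Φ → ℕ} (φ : Φ) {c : Φ → ℕ} (hc : c ∈ Fintype.piFinset fun φ => Finset.range (n φ + 1)) (hc0 : c φ = 0) :
    {b ∈ Fintype.piFinset (fun φ => Finset.range (n φ + 1)) | Function.update b φ 0 = c} =
      (Finset.range (n φ + 1)).image (fun j => Function.update c φ j) := by
  ext b
  simp only [Finset.mem_filter, Finset.mem_image, Fintype.mem_piFinset]
  constructor
  · rintro ⟨hbB, hbc⟩
    refine ⟨b φ, hbB φ, ?_⟩
    rw [← hbc, Function.update_idem, Function.update_eq_self]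
  · rintro ⟨j, hj, rfl⟩
    refine ⟨fun ψ => ?_, ?_⟩
    · by_cases h : ψ = φ
      · subst h; rw [Function.update_self]; exact hj
      · rw [Function.update_of_ne h]; exact (Fintype.mem_piFinset.1 hc) ψ
    · rw [Function.update_idem, ← hc0, Function.update_eq_self]

/-- **A LINE SUM IS THE GRID SUM** of family `φ` through the base point (`j ↦ update c φ j` is injective). [bookkeeping] -/
theorem sum_piBox_line_eq {n : Φ → ℕ} (φ : Φ) (sh : (Φ → ℕ) → ℝ) {c : Φ → ℕ}
    (hc : c ∈ (Fintype.piFinset fun φ => Finset.range (n φ + 1)).image (fun b => Function.update b φ 0)) :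
    ∑ b ∈ Fintype.piFinset (fun φ => Finset.range (n φ + 1)) with Function.update b φ 0 = c, sh b =
      ∑ j ∈ Finset.range (n φ + 1), sh (Function.update c φ j) := by
  obtain ⟨b₀, hb₀, rfl⟩ := Finset.mem_image.1 hc
  rw [piBox_line_eq φ (update_zero_mem_piBox hb₀ φ) (by rw [Function.update_self]),
    Finset.sum_image fun j _ j' _ h => Function.update_injective _ φ h]

/-- **LINE COUNT**: `#(lines along φ) · (n φ + 1) = #(box)`. [bookkeeping: `Finset.card_eq_sum_card_image`] -/
theorem card_lines_mul_eq_card_piBox {n : Φ → ℕ} (φ : Φ) :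
    (#((Fintype.piFinset fun φ => Finset.range (n φ + 1)).image (fun b => Function.update b φ 0)) : ℝ) * (n φ + 1 : ℕ) =
      #(Fintype.piFinset fun φ => Finset.range (n φ + 1)) := by
  have h := Finset.card_eq_sum_card_image (fun b : Φ → ℕ => Function.update b φ 0) (Fintype.piFinset fun φ => Finset.range (n φ + 1))
  rw [h, Nat.cast_sum]
  rw [Finset.sum_congr rfl fun c hc => ?_]
  · rw [Finset.sum_const, nsmul_eq_mul]
  · -- each line has `n φ + 1` points
    have := sum_piBox_line_eq (n := n) φ (fun _ => (1 : ℝ)) hc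
    simp only [Finset.sum_const, nsmul_eq_mul, mul_one, Finset.card_range] at this
    exact this

/-- ★★★ **JOINT LETTER SELECTION ON THE `m`-FAMILY BOX, TWO RUNS, ONE COMMON POINT**: families `φ : Φ` with grids `range (n φ + 1)`, nonnegative shells
`shA φ`, `shB φ` on the box `piFinset (fun φ => range (n φ + 1))`, and FOR EVERY POINT `c` OF THE BOX the per-line counts
`Σ_{j ≤ n φ} shA φ (update c φ j) ≤ C^A φ · Z^A`, `Σ_{j ≤ n φ} shB φ (update c φ j) ≤ C^B φ · Z^B` (family `φ` counted along ITS OWN grid, the other letters frozen)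
⇒ some COMMON letter vector `b` of the box has `Σ_φ shA φ b ≤ 2·(Σ_φ C^A φ∕(n φ+1))·Z^A` AND `Σ_φ shB φ b ≤ 2·(Σ_φ C^B φ∕(n φ+1))·Z^B`. [folklore] -/
theorem exists_common_joint_piBox_le {n : Φ → ℕ} {shA shB : Φ → (Φ → ℕ) → ℝ} {CA CB : Φ → ℝ} {ZA ZB : ℝ}
    (hA0 : ∀ φ, ∀ b ∈ Fintype.piFinset (fun φ => Finset.range (n φ + 1)), 0 ≤ shA φ b)
    (hB0 : ∀ φ, ∀ b ∈ Fintype.piFinset (fun φ => Finset.range (n φ + 1)), 0 ≤ shB φ b)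
    (hlineA : ∀ φ, ∀ c ∈ Fintype.piFinset (fun φ => Finset.range (n φ + 1)), ∑ j ∈ Finset.range (n φ + 1), shA φ (Function.update c φ j) ≤ CA φ * ZA)
    (hlineB : ∀ φ, ∀ c ∈ Fintype.piFinset (fun φ => Finset.range (n φ + 1)), ∑ j ∈ Finset.range (n φ + 1), shB φ (Function.update c φ j) ≤ CB φ * ZB) :
    ∃ b ∈ Fintype.piFinset (fun φ => Finset.range (n φ + 1)),
      ∑ φ, shA φ b ≤ 2 * (∑ φ, CA φ / (n φ + 1 : ℕ)) * ZA ∧ ∑ φ, shB φ b ≤ 2 * (∑ φ, CB φ / (n φ + 1 : ℕ)) * ZB := by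
  set B := Fintype.piFinset fun φ : Φ => Finset.range (n φ + 1) with hBdef
  have hne : B.Nonempty := ⟨fun _ => 0, Fintype.mem_piFinset.2 fun φ => Finset.mem_range.2 (Nat.succ_pos _)⟩
  have hfibA : ∀ φ ∈ (Finset.univ : Finset Φ), ∀ c ∈ B.image (fun b => Function.update b φ 0),
      ∑ b ∈ B with Function.update b φ 0 = c, shA φ b ≤ CA φ * ZA := by
    intro φ _ c hc
    rw [sum_piBox_line_eq φ (shA φ) hc]
    obtain ⟨b₀, hb₀, rfl⟩ := Finset.mem_image.1 hc
    exact hlineA φ _ (update_zero_mem_piBox hb₀ φ)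
  have hfibB : ∀ φ ∈ (Finset.univ : Finset Φ), ∀ c ∈ B.image (fun b => Function.update b φ 0),
      ∑ b ∈ B with Function.update b φ 0 = c, shB φ b ≤ CB φ * ZB := by
    intro φ _ c hc
    rw [sum_piBox_line_eq φ (shB φ) hc]
    obtain ⟨b₀, hb₀, rfl⟩ := Finset.mem_image.1 hc
    exact hlineB φ _ (update_zero_mem_piBox hb₀ φ)
  obtain ⟨b, hb, h₁, h₂⟩ := exists_common_joint_le hne Finset.univ (fun φ b => Function.update b φ 0) (fun φ _ b hb => hA0 φ b hb)
    (fun φ _ b hb => hB0 φ b hb) hfibA hfibB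
  have hconv : ∀ C : Φ → ℝ, (∑ φ, (#(B.image fun b => Function.update b φ 0) : ℝ) * C φ) / #B = ∑ φ, C φ / (n φ + 1 : ℕ) := by
    intro C
    rw [Finset.sum_div]
    refine Finset.sum_congr rfl fun φ _ => ?_
    have hc : (#(B.image fun b => Function.update b φ 0) : ℝ) * (n φ + 1 : ℕ) = #B := card_lines_mul_eq_card_piBox (n := n) φ
    have hB0 : (#B : ℝ) ≠ 0 := by exact_mod_cast (Finset.card_pos.2 hne).ne'
    have hn : ((n φ + 1 : ℕ) : ℝ) ≠ 0 := by positivity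
    rw [← hc]
    field_simp
  refine ⟨b, hb, ?_, ?_⟩
  · calc ∑ φ, shA φ b ≤ 2 * (∑ φ, (#(B.image fun b => Function.update b φ 0) : ℝ) * CA φ) / #B * ZA := h₁
      _ = 2 * ((∑ φ, (#(B.image fun b => Function.update b φ 0) : ℝ) * CA φ) / #B) * ZA := by rw [mul_div_assoc]
      _ = 2 * (∑ φ, CA φ / (n φ + 1 : ℕ)) * ZA := by rw [hconv]
  · calc ∑ φ, shB φ b ≤ 2 * (∑ φ, (#(B.image fun b => Function.update b φ 0) : ℝ) * CB φ) / #B * ZB := h₂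
      _ = 2 * ((∑ φ, (#(B.image fun b => Function.update b φ 0) : ℝ) * CB φ) / #B) * ZB := by rw [mul_div_assoc]
      _ = 2 * (∑ φ, CB φ / (n φ + 1 : ℕ)) * ZB := by rw [hconv]

end PiBox

end Summit.QuantumFields.YangMills.Theorems.N21JointLetterSelection
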